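import Literature.Analysis.Toeplitz.KochDeterminant
import Literature.Analysis.Toeplitz.CircleSymbols
import HarnessLib

/-!
# The Basor–Helton commutator of a geometric symbol and its bicharacter property

Topic `Analysis/Toeplitz`, namespace `Literature.Analysis.Toeplitz` (construction objects in the
sub-namespace `Szego`). The operator-theoretic core of the proof of the strong Szegő limit theorem
for symbols `e^V` with geometrically decaying Fourier coefficients of `V`
(`StrongSzegoGeometric.lean`), following the Basor–Helton pathway as summarised in
P. Deift, A. Its, I. Krasovsky, Comm. Pure Appl. Math. 66 (2013), §3:

  `D_n(φ) = ((φ₊)₀ (φ₋)₀)ⁿ det (P_n {T(φ₊)⁻¹, T(φ₋)} P_n)`,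
  `{T(φ₊)⁻¹, T(φ₋)} = 1 + T(φ₊)⁻¹ [T(φ₋), T(φ₊)] T(φ₋)⁻¹`,  `[T(φ₋), T(φ₊)] = H(φ₊)H(φ̃₋)`,

with `φ = e^V = e^{v₀} φ₊ φ₋`, `φ₊ = e^{V₊}`, `φ₋ = e^{V₋}`. Everything is an honest identity in the
ring `DomMat τ` of dominated infinite matrices (`DominatedMatrix.lean`), the triangular Toeplitz
matrices `X s = T(e^{sV₊}) = L(expSeq (s • posSeq v))`, `Y t = T(e^{tV₋}) = U(expSeq (t • negSeq v))`
being one-parameter groups of units (`X_mul_X`, `Y_mul_Y`), and the commutation rule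
`Y t X s = X s Y t + Hk s t` (`ToeplitzHankel.imul_upperT_lowerT`).

## Main results (all proved)

* `Szego.IsGeomSymbol V Cv r` — the hypotheses: `V` continuous, `2π`-periodic,
  `‖circleCoeff V k‖ ≤ Cv r^{|k|}`, `0 ≤ r < 1`; rates `sig r = (r+1)/2` (sequences),
  `tau r = (r+3)/4` (matrices);
* `Szego.Cm s t = X (-s) * Y t * X s * Y (-t) = 1 + X (-s) * Hk s t * Y (-t)` (`Cm_eq_one_add`), the
  corner kernel `Szego.K s t` with `(Cm s t : Matrix) = 1 + K s t` and its von Koch determinant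
  `Szego.f s t = detOnePlus (K s t)`;
* **`toeplitzDet_eq`** — `D_n(e^V) = e^{n v₀} det (1 + P_n (K 1 1) P_n)` for every `n`, hence
  `tendsto_toeplitzDet_div` : `D_n(e^V)/e^{n v₀} → f 1 1`;
* **the bicharacter property** `f_add_left : f (s + s') t = f s t * f s' t`,
  `f_add_right : f s (t + t') = f s t * f s t'` (group identities for the commutators,
  multiplicativity and Sylvester's identity of von Koch determinants), and
  `f_one_one_eq_pow : f 1 1 = (f (2^{-m}) (2^{-m}))^(4^m)`.

The evaluation `f 1 1 = exp (∑ k v_k v_{-k})` (second-order expansion of `f ε ε`) is the sibling file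
`StrongSzegoGeometric.lean`.

## References

* P. Deift, A. Its, I. Krasovsky, Comm. Pure Appl. Math. 66 (2013) 1360–1438, §3 (the Basor–Helton
  and Widom proofs of the strong Szegő limit theorem).
* E. Basor, J. W. Helton, *A new proof of the Szegő limit theorem and new results for Toeplitz
  operators with discontinuous symbol*, J. Operator Theory 3 (1980) 23–39, Thm. 2.1.
-/

noncomputable section

open Finset Filter Complex Matrix
open scoped _root_.Topology BigOperators Real

namespace Literature.Analysis.Toeplitz

/-! ### Small complements to the earlier files -/

/-- Weakening the constant of a row bound. [folklore] -/
theorem IsRowDom.mono {ρ α β : ℝ} {A : Matrix ℕ ℕ ℂ} (h : IsRowDom ρ α A) (hρ : 0 ≤ ρ) (hαβ : α ≤ β) :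
    IsRowDom ρ β A := fun i => ⟨(h i).1, (h i).2.trans (mul_le_mul_of_nonneg_right hαβ (pow_nonneg hρ _))⟩

/-- Weakening the constant of a column bound. [folklore] -/
theorem IsColDom.mono {ρ α β : ℝ} {A : Matrix ℕ ℕ ℂ} (h : IsColDom ρ α A) (hρ : 0 ≤ ρ) (hαβ : α ≤ β) :
    IsColDom ρ β A := fun j => ⟨(h j).1, (h j).2.trans (mul_le_mul_of_nonneg_right hαβ (pow_nonneg hρ _))⟩

/-- Corner bounds transfer to a larger rate. [folklore] -/
theorem IsCorner.mono_rate {ρ σ C : ℝ} {K : Matrix ℕ ℕ ℂ} (h : IsCorner ρ C K) (hρ : 0 ≤ ρ) (hρσ : ρ ≤ σ) :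
    IsCorner σ C K := fun i j =>
  (h i j).trans (mul_le_mul_of_nonneg_left (pow_le_pow_left₀ hρ hρσ _) h.nonneg)

/-- The geometric majorant scales linearly in its constant. [folklore] -/
theorem geomMajorant_eq_smul (r D : ℝ) : geomMajorant r D = D • geomMajorant r 1 := by
  funext k; simp [geomMajorant]

/-- The weighted norm of the geometric majorant `D r^{|k|}` is `D` times that of `r^{|k|}`. [folklore] -/
theorem wnorm_geomMajorant (σ r D : ℝ) : wnorm σ (geomMajorant r D) = D * wnorm σ (geomMajorant r 1) := by
  rw [geomMajorant_eq_smul, wnorm_smul]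

/-- `hankelT` only sees the entries of index `≥ 1`. [folklore] -/
theorem hankelT_congr {a a' c c' : ℕ → ℂ} (ha : ∀ n, 1 ≤ n → a n = a' n) (hc : ∀ n, 1 ≤ n → c n = c' n) :
    hankelT a c = hankelT a' c' := by
  ext i j
  simp only [hankelT_apply]
  exact tsum_congr fun p => by rw [ha _ (by omega), hc _ (by omega)]

namespace Szego

/-! ### The hypotheses and the rates -/

/-- **A geometric symbol exponent**: `V : ℝ → ℂ` continuous and `2π`-periodic whose Fourier
coefficients decay geometrically, `‖circleCoeff V k‖ ≤ Cv r^{|k|}` with `0 ≤ r < 1` (so that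
`e^V` is a symbol analytic in an annulus, with zero winding number and the continuous logarithm
`V`). [folklore] -/
structure IsGeomSymbol (V : ℝ → ℂ) (Cv r : ℝ) : Prop where
  continuous : Continuous V
  periodic : Function.Periodic V (2 * Real.pi)
  coeff_le : ∀ k, ‖circleCoeff V k‖ ≤ Cv * r ^ k.natAbs
  rate_nonneg : 0 ≤ r
  rate_lt_one : r < 1

/-- The rate of the coefficient sequences, `σ = (r+1)/2 ∈ (r, 1)`. [folklore] -/
def sig (r : ℝ) : ℝ := (r + 1) / 2

/-- The rate of the matrix algebra, `τ = (r+3)/4 ∈ (σ, 1)`. [folklore] -/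
def tau (r : ℝ) : ℝ := (r + 3) / 4

section Rates

variable {V : ℝ → ℂ} {Cv r : ℝ}

/-- `0 < σ`. [folklore] -/
theorem sig_pos (h : IsGeomSymbol V Cv r) : 0 < sig r := by
  have := h.rate_nonneg; rw [sig]; linarith

/-- `r < σ`. [folklore] -/
theorem lt_sig (h : IsGeomSymbol V Cv r) : r < sig r := by
  have := h.rate_lt_one; rw [sig]; linarith

/-- `σ < 1`. [folklore] -/
theorem sig_lt_one (h : IsGeomSymbol V Cv r) : sig r < 1 := by
  have := h.rate_lt_one; rw [sig]; linarith

/-- `σ < τ`. [folklore] -/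
theorem sig_lt_tau (h : IsGeomSymbol V Cv r) : sig r < tau r := by
  have := h.rate_lt_one; rw [sig, tau]; linarith

/-- `0 < τ`. [folklore] -/
theorem tau_pos (h : IsGeomSymbol V Cv r) : 0 < tau r := by
  have := h.rate_nonneg; rw [tau]; linarith

/-- `τ < 1`. [folklore] -/
theorem tau_lt_one (h : IsGeomSymbol V Cv r) : tau r < 1 := by
  have := h.rate_lt_one; rw [tau]; linarith

/-- `0 ≤ Cv`. [folklore] -/
theorem const_nonneg (h : IsGeomSymbol V Cv r) : 0 ≤ Cv := by
  have := h.coeff_le 0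
  simp only [Int.natAbs_zero, pow_zero, mul_one] at this
  exact (norm_nonneg _).trans this

end Rates

/-! ### The coefficient sequences -/

section Sequences

variable {V : ℝ → ℂ} {Cv r : ℝ}

/-- The positive-frequency coefficients `a₊ n = v n` (`n ≥ 1`) of `V`. [folklore] -/
def aPos (V : ℝ → ℂ) : ℕ → ℂ := posSeq (circleCoeff V)

/-- The negative-frequency coefficients `a₋ n = v (-n)` (`n ≥ 1`) of `V`. [folklore] -/
def aNeg (V : ℝ → ℂ) : ℕ → ℂ := negSeq (circleCoeff V)

/-- The coefficients of `φ₊^s = e^{sV₊}`: `eP V s = expSeq (s • a₊)`. [folklore] -/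
def eP (V : ℝ → ℂ) (s : ℂ) : ℕ → ℂ := expSeq (s • aPos V)

/-- The coefficients of `φ₋^t = e^{tV₋}` (as a series in `e^{-iθ}`): `eN V t = expSeq (t • a₋)`. [folklore] -/
def eN (V : ℝ → ℂ) (t : ℂ) : ℕ → ℂ := expSeq (t • aNeg V)

/-- The weighted norm `w₊ = wn σ a₊`. [folklore] -/
def wP (V : ℝ → ℂ) (r : ℝ) : ℝ := wn (sig r) (aPos V)

/-- The weighted norm `w₋ = wn σ a₋`. [folklore] -/
def wN (V : ℝ → ℂ) (r : ℝ) : ℝ := wn (sig r) (aNeg V)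

/-- `a₊` is weighted-summable at rate `σ`. [folklore] -/
theorem isSumW_aPos (h : IsGeomSymbol V Cv r) : IsSumW (sig r) (aPos V) :=
  (isSumW_of_isGeom (isGeom_posSeq h.coeff_le) h.rate_nonneg (sig_pos h) (lt_sig h)).1

/-- `a₋` is weighted-summable at rate `σ`. [folklore] -/
theorem isSumW_aNeg (h : IsGeomSymbol V Cv r) : IsSumW (sig r) (aNeg V) :=
  (isSumW_of_isGeom (isGeom_negSeq h.coeff_le) h.rate_nonneg (sig_pos h) (lt_sig h)).1

/-- `0 ≤ w₊`. [folklore] -/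
theorem wP_nonneg (h : IsGeomSymbol V Cv r) : 0 ≤ wP V r := wn_nonneg (sig_pos h).le _

/-- `0 ≤ w₋`. [folklore] -/
theorem wN_nonneg (h : IsGeomSymbol V Cv r) : 0 ≤ wN V r := wn_nonneg (sig_pos h).le _

/-- `a₊ 0 = 0`. [folklore] -/
@[simp] theorem aPos_zero (V : ℝ → ℂ) : aPos V 0 = 0 := rfl

/-- `a₋ 0 = 0`. [folklore] -/
@[simp] theorem aNeg_zero (V : ℝ → ℂ) : aNeg V 0 = 0 := rfl

/-- **The geometric bound for `eP`**: `‖eP V s n‖ ≤ e^{‖s‖ w₊} σⁿ`. [folklore] -/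
theorem isGeom_eP (h : IsGeomSymbol V Cv r) (s : ℂ) :
    IsGeom (sig r) (Real.exp (‖s‖ * wP V r)) (eP V s) := by
  have := isGeom_expSeq ((isSumW_aPos h).smul s) (sig_pos h)
  rwa [wn_smul] at this

/-- **The geometric bound for `eN`**: `‖eN V t n‖ ≤ e^{‖t‖ w₋} σⁿ`. [folklore] -/
theorem isGeom_eN (h : IsGeomSymbol V Cv r) (t : ℂ) :
    IsGeom (sig r) (Real.exp (‖t‖ * wN V r)) (eN V t) := by
  have := isGeom_expSeq ((isSumW_aNeg h).smul t) (sig_pos h)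
  rwa [wn_smul] at this

/-- `eP V 0 = δ₀`. [folklore] -/
@[simp] theorem eP_zero (V : ℝ → ℂ) : eP V 0 = delta := by simp [eP]

/-- `eN V 0 = δ₀`. [folklore] -/
@[simp] theorem eN_zero (V : ℝ → ℂ) : eN V 0 = delta := by simp [eN]

/-- `eP V s 0 = 1` (`a₊ 0 = 0`). [folklore] -/
@[simp] theorem eP_apply_zero (V : ℝ → ℂ) (s : ℂ) : eP V s 0 = 1 :=
  expSeq_apply_zero (by simp [aPos])

/-- `eN V t 0 = 1`. [folklore] -/
@[simp] theorem eN_apply_zero (V : ℝ → ℂ) (t : ℂ) : eN V t 0 = 1 :=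
  expSeq_apply_zero (by simp [aNeg])

/-- **Group law** `eP s ⋆ eP s' = eP (s + s')`. [folklore] -/
theorem cauchyProd_eP (h : IsGeomSymbol V Cv r) (s s' : ℂ) :
    cauchyProd (eP V s) (eP V s') = eP V (s + s') :=
  cauchyProd_expSeq_smul (isSumW_aPos h) (sig_pos h) (sig_lt_one h) s s'

/-- **Group law** `eN t ⋆ eN t' = eN (t + t')`. [folklore] -/
theorem cauchyProd_eN (h : IsGeomSymbol V Cv r) (t t' : ℂ) :
    cauchyProd (eN V t) (eN V t') = eN V (t + t') :=
  cauchyProd_expSeq_smul (isSumW_aNeg h) (sig_pos h) (sig_lt_one h) t t'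

end Sequences

/-! ### The matrices in the ring `DomMat τ` -/

section Matrices

variable {V : ℝ → ℂ} {Cv r : ℝ}

/-- The weighted norm constant of the geometric majorant `σ^{|k|}` in `W_τ`. [folklore] -/
def gconst (r : ℝ) : ℝ := wnorm (tau r) (geomMajorant (sig r) 1)

/-- `0 ≤ gconst r`. [folklore] -/
theorem gconst_nonneg (h : IsGeomSymbol V Cv r) : 0 ≤ gconst r :=
  wnorm_nonneg (isWSeq_geomMajorant (tau_pos h) (sig_pos h).le (sig_lt_tau h) zero_le_one) (tau_pos h).le

/-- **`X s = T(φ₊^s) = L(eP V s)`** as an element of `DomMat τ`. [folklore] -/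
def X (h : IsGeomSymbol V Cv r) (s : ℂ) : DomMat (tau r) :=
  DomMat.mk' (lowerT (eP V s))
    (isWSeq_geomMajorant (tau_pos h) (sig_pos h).le (sig_lt_tau h) (isGeom_eP h s).nonneg) le_rfl
    (isDom_lowerT (isGeom_eP h s) (sig_pos h).le (tau r))

/-- **`Y t = T(φ₋^t) = U(eN V t)`** as an element of `DomMat τ`. [folklore] -/
def Y (h : IsGeomSymbol V Cv r) (t : ℂ) : DomMat (tau r) :=
  DomMat.mk' (upperT (eN V t))
    (isWSeq_geomMajorant (tau_pos h) (sig_pos h).le (sig_lt_tau h) (isGeom_eN h t).nonneg) le_rfl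
    (isDom_upperT (isGeom_eN h t) (sig_pos h).le (tau r))

/-- The corner constant of the Hankel product `Hk s t`. [folklore] -/
def hkConst (V : ℝ → ℂ) (r : ℝ) (s t : ℂ) : ℝ :=
  Real.exp (‖s‖ * wP V r) * Real.exp (‖t‖ * wN V r) * sig r ^ 2 / (1 - sig r ^ 2)

/-- `0 ≤ hkConst`. [folklore] -/
theorem hkConst_nonneg (h : IsGeomSymbol V Cv r) (s t : ℂ) : 0 ≤ hkConst V r s t :=
  hankelT_const_nonneg (isGeom_eP h s) (isGeom_eN h t) (sig_pos h).le (sig_lt_one h)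

/-- **`Hk s t = H(φ₊^s) H(φ̃₋^t) = hankelT (eP V s) (eN V t)`** as an element of `DomMat τ`
(a corner kernel). [folklore] -/
def Hk (h : IsGeomSymbol V Cv r) (s t : ℂ) : DomMat (tau r) :=
  DomMat.mk' (hankelT (eP V s) (eN V t)) (IsWSeq.zero (tau r)) (hkConst_nonneg h s t)
    (IsDom.of_isCorner (isCorner_hankelT_of_le (isGeom_eP h s) (isGeom_eN h t) (sig_pos h).le
      (sig_lt_one h) (sig_lt_tau h).le))

/-- The matrix of `X`. [folklore] -/
@[simp] theorem coe_X (h : IsGeomSymbol V Cv r) (s : ℂ) : (X h s : Matrix ℕ ℕ ℂ) = lowerT (eP V s) := rfl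

/-- The matrix of `Y`. [folklore] -/
@[simp] theorem coe_Y (h : IsGeomSymbol V Cv r) (t : ℂ) : (Y h t : Matrix ℕ ℕ ℂ) = upperT (eN V t) := rfl

/-- The matrix of `Hk`. [folklore] -/
@[simp] theorem coe_Hk (h : IsGeomSymbol V Cv r) (s t : ℂ) :
    (Hk h s t : Matrix ℕ ℕ ℂ) = hankelT (eP V s) (eN V t) := rfl

/-- `Fact (0 < τ)` from `Fact (0 ≤ r)`, for the ring structure on `DomMat τ`. [folklore] -/
theorem fact_tau_pos [hr : Fact (0 ≤ r)] : Fact (0 < tau r) := ⟨by have := hr.out; rw [tau]; linarith⟩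

/-- `Fact (τ < 1)` from `Fact (r < 1)`, for the ring structure on `DomMat τ`. [folklore] -/
theorem fact_tau_lt_one [hr : Fact (r < 1)] : Fact (tau r < 1) := ⟨by have := hr.out; rw [tau]; linarith⟩

attribute [local instance] fact_tau_pos fact_tau_lt_one

variable [Fact (0 ≤ r)] [Fact (r < 1)]

/-- **`X` is a one-parameter group**: `X s * X s' = X (s + s')`. [folklore] -/
theorem X_mul_X (h : IsGeomSymbol V Cv r) (s s' : ℂ) :
    X h s * X h s' = X h (s + s') := by
  refine DomMat.ext ?_
  rw [DomMat.coe_mul, coe_X, coe_X, coe_X, imul_lowerT_lowerT, cauchyProd_eP h]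

/-- **`Y` is a one-parameter group**: `Y t * Y t' = Y (t + t')`. [folklore] -/
theorem Y_mul_Y (h : IsGeomSymbol V Cv r) (t t' : ℂ) :
    Y h t * Y h t' = Y h (t + t') := by
  refine DomMat.ext ?_
  rw [DomMat.coe_mul, coe_Y, coe_Y, coe_Y, imul_upperT_upperT, cauchyProd_eN h]

omit [Fact (0 ≤ r)] [Fact (r < 1)] in
/-- `X 0 = 1`. [folklore] -/
@[simp] theorem X_zero (h : IsGeomSymbol V Cv r) : X h 0 = 1 :=
  DomMat.ext (by rw [coe_X, eP_zero, lowerT_delta, DomMat.coe_one])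

omit [Fact (0 ≤ r)] [Fact (r < 1)] in
/-- `Y 0 = 1`. [folklore] -/
@[simp] theorem Y_zero (h : IsGeomSymbol V Cv r) : Y h 0 = 1 :=
  DomMat.ext (by rw [coe_Y, eN_zero, upperT_delta, DomMat.coe_one])

/-- Cancellation `X (-s) * (X s * M) = M`. [folklore] -/
theorem X_neg_mul_X_mul (h : IsGeomSymbol V Cv r) (s : ℂ) (M : DomMat (tau r)) :
    X h (-s) * (X h s * M) = M := by
  rw [← mul_assoc, X_mul_X, neg_add_cancel, X_zero, one_mul]

/-- Cancellation `X s * (X (-s) * M) = M`. [folklore] -/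
theorem X_mul_X_neg_mul (h : IsGeomSymbol V Cv r) (s : ℂ) (M : DomMat (tau r)) :
    X h s * (X h (-s) * M) = M := by
  rw [← mul_assoc, X_mul_X, add_neg_cancel, X_zero, one_mul]

/-- Cancellation `Y (-t) * (Y t * M) = M`. [folklore] -/
theorem Y_neg_mul_Y_mul (h : IsGeomSymbol V Cv r) (t : ℂ) (M : DomMat (tau r)) :
    Y h (-t) * (Y h t * M) = M := by
  rw [← mul_assoc, Y_mul_Y, neg_add_cancel, Y_zero, one_mul]

/-- Cancellation `Y t * (Y (-t) * M) = M`. [folklore] -/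
theorem Y_mul_Y_neg_mul (h : IsGeomSymbol V Cv r) (t : ℂ) (M : DomMat (tau r)) :
    Y h t * (Y h (-t) * M) = M := by
  rw [← mul_assoc, Y_mul_Y, add_neg_cancel, Y_zero, one_mul]

/-- `X (-s) * X s = 1`. [folklore] -/
theorem X_neg_mul_X (h : IsGeomSymbol V Cv r) (s : ℂ) : X h (-s) * X h s = 1 := by
  rw [X_mul_X, neg_add_cancel, X_zero]

/-- `Y (-t) * Y t = 1`. [folklore] -/
theorem Y_neg_mul_Y (h : IsGeomSymbol V Cv r) (t : ℂ) : Y h (-t) * Y h t = 1 := by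
  rw [Y_mul_Y, neg_add_cancel, Y_zero]

/-- `X s * X (-s) = 1`. [folklore] -/
theorem X_mul_X_neg (h : IsGeomSymbol V Cv r) (s : ℂ) :
    X h s * X h (-s) = 1 := by
  rw [X_mul_X, add_neg_cancel, X_zero]

/-- `Y t * Y (-t) = 1`. [folklore] -/
theorem Y_mul_Y_neg (h : IsGeomSymbol V Cv r) (t : ℂ) :
    Y h t * Y h (-t) = 1 := by
  rw [Y_mul_Y, add_neg_cancel, Y_zero]

/-- **The commutation rule** `Y t * X s = X s * Y t + Hk s t` (`[T(φ₋^t), T(φ₊^s)] = H H̃`). [folklore] -/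
theorem Y_mul_X (h : IsGeomSymbol V Cv r) (s t : ℂ) :
    Y h t * X h s = X h s * Y h t + Hk h s t := by
  refine DomMat.ext ?_
  rw [DomMat.coe_mul, DomMat.coe_add, DomMat.coe_mul, coe_X, coe_Y, coe_Hk]
  exact imul_upperT_lowerT (isGeom_eP h s) (isGeom_eN h t) (sig_pos h) (sig_lt_one h)

/-! ### The commutator and its kernel -/

/-- **The multiplicative commutator** `Cm s t = X (-s) * Y t * X s * Y (-t) = {T(φ₊^s)⁻¹, T(φ₋^t)}`
(Deift–Its–Krasovsky 2013, §3, Basor–Helton). [folklore] -/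
def Cm (h : IsGeomSymbol V Cv r) (s t : ℂ) : DomMat (tau r) :=
  X h (-s) * Y h t * X h s * Y h (-t)

/-- **`{T(φ₊)⁻¹, T(φ₋)} = 1 + T(φ₊)⁻¹ [T(φ₋), T(φ₊)] T(φ₋)⁻¹`**:
`Cm s t = 1 + X (-s) * Hk s t * Y (-t)`. [folklore] -/
theorem Cm_eq_one_add (h : IsGeomSymbol V Cv r) (s t : ℂ) :
    Cm h s t = 1 + X h (-s) * Hk h s t * Y h (-t) := by
  rw [Cm]
  calc X h (-s) * Y h t * X h s * Y h (-t) = X h (-s) * (Y h t * X h s) * Y h (-t) := by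
        simp only [mul_assoc]
    _ = X h (-s) * (X h s * Y h t + Hk h s t) * Y h (-t) := by rw [Y_mul_X]
    _ = (X h (-s) * X h s) * (Y h t * Y h (-t)) + X h (-s) * Hk h s t * Y h (-t) := by noncomm_ring
    _ = 1 + X h (-s) * Hk h s t * Y h (-t) := by
        rw [X_mul_X, neg_add_cancel, X_zero, Y_mul_Y_neg, one_mul]

/-- **The kernel** `K s t = T(φ₊^s)⁻¹ H(φ₊^s) H(φ̃₋^t) T(φ₋^t)⁻¹`, a corner kernel, with
`Cm s t = 1 + K s t`. [folklore] -/
def K (h : IsGeomSymbol V Cv r) (s t : ℂ) : Matrix ℕ ℕ ℂ :=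
  ((X h (-s) * Hk h s t * Y h (-t) : DomMat (tau r)) : Matrix ℕ ℕ ℂ)

/-- `(Cm s t : Matrix) = 1 + K s t`. [folklore] -/
theorem coe_Cm (h : IsGeomSymbol V Cv r) (s t : ℂ) : (Cm h s t : Matrix ℕ ℕ ℂ) = 1 + K h s t := by
  rw [Cm_eq_one_add, DomMat.coe_add, DomMat.coe_one, K]

/-- The von Koch determinant **`f s t = det {T(φ₊^s)⁻¹, T(φ₋^t)} = detOnePlus (K s t)`**. [folklore] -/
def f (h : IsGeomSymbol V Cv r) (s t : ℂ) : ℂ := detOnePlus (K h s t)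

/-- The row constant of `X s`. [folklore] -/
def xConst (V : ℝ → ℂ) (r : ℝ) (s : ℂ) : ℝ := Real.exp (‖s‖ * wP V r) * gconst r

omit [Fact (0 ≤ r)] [Fact (r < 1)] in
/-- `X s` is row-dominated with constant `e^{‖s‖ w₊} · gconst`. [folklore] -/
theorem isRowDom_X (h : IsGeomSymbol V Cv r) (s : ℂ) :
    IsRowDom (tau r) (xConst V r s) (X h s : Matrix ℕ ℕ ℂ) := by
  have hD := isDom_lowerT (isGeom_eP h s) (sig_pos h).le (tau r)
  have := hD.isRowDom (isWSeq_geomMajorant (tau_pos h) (sig_pos h).le (sig_lt_tau h)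
    (isGeom_eP h s).nonneg) (tau_pos h) (tau_lt_one h)
  rw [zero_div, add_zero, wnorm_geomMajorant] at this
  exact this

omit [Fact (0 ≤ r)] [Fact (r < 1)] in
/-- `X s` is column-dominated with the same constant. [folklore] -/
theorem isColDom_X (h : IsGeomSymbol V Cv r) (s : ℂ) :
    IsColDom (tau r) (xConst V r s) (X h s : Matrix ℕ ℕ ℂ) := by
  have hD := isDom_lowerT (isGeom_eP h s) (sig_pos h).le (tau r)
  have := hD.isColDom (isWSeq_geomMajorant (tau_pos h) (sig_pos h).le (sig_lt_tau h)
    (isGeom_eP h s).nonneg) (tau_pos h) (tau_lt_one h)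
  rw [zero_div, add_zero, wnorm_geomMajorant] at this
  exact this

/-- The column constant of `Y t`. [folklore] -/
def yConst (V : ℝ → ℂ) (r : ℝ) (t : ℂ) : ℝ := Real.exp (‖t‖ * wN V r) * gconst r

omit [Fact (0 ≤ r)] [Fact (r < 1)] in
/-- `Y t` is row-dominated. [folklore] -/
theorem isRowDom_Y (h : IsGeomSymbol V Cv r) (t : ℂ) :
    IsRowDom (tau r) (yConst V r t) (Y h t : Matrix ℕ ℕ ℂ) := by
  have hD := isDom_upperT (isGeom_eN h t) (sig_pos h).le (tau r)
  have := hD.isRowDom (isWSeq_geomMajorant (tau_pos h) (sig_pos h).le (sig_lt_tau h)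
    (isGeom_eN h t).nonneg) (tau_pos h) (tau_lt_one h)
  rw [zero_div, add_zero, wnorm_geomMajorant] at this
  exact this

omit [Fact (0 ≤ r)] [Fact (r < 1)] in
/-- `Y t` is column-dominated. [folklore] -/
theorem isColDom_Y (h : IsGeomSymbol V Cv r) (t : ℂ) :
    IsColDom (tau r) (yConst V r t) (Y h t : Matrix ℕ ℕ ℂ) := by
  have hD := isDom_upperT (isGeom_eN h t) (sig_pos h).le (tau r)
  have := hD.isColDom (isWSeq_geomMajorant (tau_pos h) (sig_pos h).le (sig_lt_tau h)
    (isGeom_eN h t).nonneg) (tau_pos h) (tau_lt_one h)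
  rw [zero_div, add_zero, wnorm_geomMajorant] at this
  exact this

omit [Fact (0 ≤ r)] [Fact (r < 1)] in
/-- `Hk s t` is a corner kernel at rate `τ` with constant `hkConst`. [folklore] -/
theorem isCorner_Hk (h : IsGeomSymbol V Cv r) (s t : ℂ) :
    IsCorner (tau r) (hkConst V r s t) (Hk h s t : Matrix ℕ ℕ ℂ) :=
  isCorner_hankelT_of_le (isGeom_eP h s) (isGeom_eN h t) (sig_pos h).le (sig_lt_one h) (sig_lt_tau h).le

/-- The corner constant of `K s t`. [folklore] -/
def kConst (V : ℝ → ℂ) (r : ℝ) (s t : ℂ) : ℝ := xConst V r (-s) * hkConst V r s t * yConst V r (-t)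

/-- **`K s t` is a corner kernel.** [folklore] -/
theorem isCorner_K (h : IsGeomSymbol V Cv r) (s t : ℂ) : IsCorner (tau r) (kConst V r s t) (K h s t) := by
  rw [K, DomMat.coe_mul, DomMat.coe_mul, kConst]
  exact ((isRowDom_X h (-s)).imul_corner (isCorner_Hk h s t) (tau_pos h).le).imul_colDom
    (isColDom_Y h (-t)) (tau_pos h).le

/-! ### `D_n(e^V) = e^{n v₀} det (1 + P_n K P_n)` -/

/-- `T(φ) = Y 1 * X 1 = X 1 * Cm 1 1 * Y 1` in the ring. [folklore] -/
theorem Y_one_mul_X_one (h : IsGeomSymbol V Cv r) :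
    Y h 1 * X h 1 = X h 1 * Cm h 1 1 * Y h 1 := by
  rw [Cm]
  simp only [mul_assoc]
  rw [Y_neg_mul_Y, mul_one, X_mul_X_neg_mul]

/-- The Toeplitz matrix of the strong Szegő limit theorem is a finite section:
`toeplitzMatrix c n = finSection n (toeplitzInf c)`. [folklore] -/
theorem toeplitzMatrix_eq_finSection (c : ℤ → ℂ) (n : ℕ) : toeplitzMatrix c n = finSection n (toeplitzInf c) := by
  ext i j; rfl

/-- **The symbol identity**: the Toeplitz matrix of `e^V` is `e^{v₀}` times the finite section of
`Y 1 * X 1 = T(φ₋)T(φ₊)`. [folklore] -/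
theorem toeplitzMatrix_exp_eq (h : IsGeomSymbol V Cv r) (n : ℕ) :
    toeplitzMatrix (circleCoeff fun θ => Complex.exp (V θ)) n =
      Complex.exp (circleCoeff V 0) • finSection n ((Y h 1 * X h 1 : DomMat (tau r)) : Matrix ℕ ℕ ℂ) := by
  rw [toeplitzMatrix_eq_finSection, DomMat.coe_mul, coe_Y, coe_X, imul_upperT_lowerT_eq_toeplitzInf,
    ← finSection_smul]
  congr 1
  ext i j
  rw [toeplitzInf_apply, Matrix.smul_apply, toeplitzInf_apply, smul_eq_mul,
    circleCoeff_exp_eq_twoSided h.continuous h.periodic h.coeff_le h.rate_nonneg h.rate_lt_one]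
  simp [eP, eN, aPos, aNeg, one_smul]

/-- **`D_n(e^V) = e^{n v₀} det (1 + P_n (K 1 1) P_n)`** (Deift–Its–Krasovsky 2013, §3:
`D_n(φ) = ((φ₊)₀(φ₋)₀)ⁿ det (P_n {T(φ₊)⁻¹, T(φ₋)} P_n)`; here `(φ±)₀ = 1` and the factor `e^{v₀}`
of `φ = e^{v₀} φ₊ φ₋` is pulled out). [folklore] -/
theorem toeplitzDet_exp_eq (h : IsGeomSymbol V Cv r) (n : ℕ) :
    toeplitzDet (circleCoeff fun θ => Complex.exp (V θ)) n =
      Complex.exp (n * circleCoeff V 0) * (1 + finSection n (K h 1 1)).det := by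
  rw [toeplitzDet, toeplitzMatrix_exp_eq h n, Matrix.det_smul, Fintype.card_fin, ← Complex.exp_nat_mul,
    Y_one_mul_X_one, mul_assoc, DomMat.coe_mul, DomMat.coe_mul, coe_X, finSection_imul_lowerT,
    coe_Y, finSection_imul_upperT, Matrix.det_mul, Matrix.det_mul, det_finSection_lowerT,
    det_finSection_upperT, eP_apply_zero, eN_apply_zero, one_pow, one_mul, mul_one, coe_Cm,
    finSection_add, finSection_one]

/-- **`D_n(e^V) / e^{n v₀} → f 1 1`** (finite sections of the von Koch determinant). [folklore] -/
theorem tendsto_toeplitzDet_div (h : IsGeomSymbol V Cv r) :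
    Tendsto (fun n : ℕ => toeplitzDet (circleCoeff fun θ => Complex.exp (V θ)) n /
        Complex.exp (n * circleCoeff V 0)) atTop (𝓝 (f h 1 1)) := by
  have ht := tendsto_det_finSection (isCorner_K h 1 1) (tau_pos h).le (tau_lt_one h)
  refine ht.congr fun n => ?_
  rw [toeplitzDet_exp_eq h n, mul_div_cancel_left₀ _ (Complex.exp_ne_zero _)]

/-! ### The bicharacter property -/

/-- The group identity behind the first bicharacter property:
`Cm (s + s') t = (X (-s') * Cm s t * X s') * Cm s' t`. [folklore] -/
theorem Cm_add_left (h : IsGeomSymbol V Cv r) (s s' t : ℂ) :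
    Cm h (s + s') t = (X h (-s') * Cm h s t * X h s') * Cm h s' t := by
  rw [Cm, Cm, Cm, neg_add, ← X_mul_X h (-s) (-s'), ← X_mul_X h s s']
  rw [show X h (-s) * X h (-s') = X h (-s') * X h (-s) by rw [X_mul_X, X_mul_X, add_comm]]
  simp only [mul_assoc]
  rw [X_mul_X_neg_mul, Y_neg_mul_Y_mul]

/-- The group identity behind the second bicharacter property:
`Cm s (t + t') = Cm s t * (Y t * Cm s t' * Y (-t))`. [folklore] -/
theorem Cm_add_right (h : IsGeomSymbol V Cv r) (s t t' : ℂ) :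
    Cm h s (t + t') = Cm h s t * (Y h t * Cm h s t' * Y h (-t)) := by
  rw [Cm, Cm, Cm, neg_add, ← Y_mul_Y h t t', ← Y_mul_Y h (-t) (-t')]
  rw [show Y h (-t) * Y h (-t') = Y h (-t') * Y h (-t) by rw [Y_mul_Y, Y_mul_Y, add_comm]]
  simp only [mul_assoc]
  rw [Y_neg_mul_Y_mul, X_mul_X_neg_mul]

/-- Conjugation of the kernel by `X`: `X (-s') * Cm s t * X s' = 1 + X (-s') * K s t * X s'` at the
level of matrices. [folklore] -/
theorem coe_conj_X (h : IsGeomSymbol V Cv r) (s s' t : ℂ) :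
    ((X h (-s') * Cm h s t * X h s' : DomMat (tau r)) : Matrix ℕ ℕ ℂ) =
      1 + imul (X h (-s') : Matrix ℕ ℕ ℂ) (imul (K h s t) (X h s' : Matrix ℕ ℕ ℂ)) := by
  have hring : X h (-s') * Cm h s t * X h s' = 1 + X h (-s') * ((X h (-s) * Hk h s t * Y h (-t)) * X h s') := by
    rw [Cm_eq_one_add, mul_add, add_mul, mul_one, X_mul_X, neg_add_cancel, X_zero]
    simp only [mul_assoc]
  rw [hring, DomMat.coe_add, DomMat.coe_one, DomMat.coe_mul, DomMat.coe_mul, K]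

/-- Conjugation of the kernel by `Y`: `Y t * Cm s t' * Y (-t) = 1 + Y t * K s t' * Y (-t)` at the level
of matrices. [folklore] -/
theorem coe_conj_Y (h : IsGeomSymbol V Cv r) (s t t' : ℂ) :
    ((Y h t * Cm h s t' * Y h (-t) : DomMat (tau r)) : Matrix ℕ ℕ ℂ) =
      1 + imul (Y h t : Matrix ℕ ℕ ℂ) (imul (K h s t') (Y h (-t) : Matrix ℕ ℕ ℂ)) := by
  have hring : Y h t * Cm h s t' * Y h (-t) = 1 + Y h t * ((X h (-s) * Hk h s t' * Y h (-t')) * Y h (-t)) := by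
    rw [Cm_eq_one_add, mul_add, add_mul, mul_one, Y_mul_Y, add_neg_cancel, Y_zero]
    simp only [mul_assoc]
  rw [hring, DomMat.coe_add, DomMat.coe_one, DomMat.coe_mul, DomMat.coe_mul, K]

/-- The product of two commutator-type elements at the level of kernels:
`(1 + A)(1 + B) = 1 + (A + B + A B)`. [folklore] -/
theorem coe_mul_eq_one_add {τ : ℝ} [Fact (0 < τ)] [Fact (τ < 1)] (P Q : DomMat τ) (A B : Matrix ℕ ℕ ℂ)
    (hP : (P : Matrix ℕ ℕ ℂ) = 1 + A) (hQ : (Q : Matrix ℕ ℕ ℂ) = 1 + B) :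
    ((P * Q : DomMat τ) : Matrix ℕ ℕ ℂ) = 1 + (A + B + imul A B) := by
  have hA : A = ((P - 1 : DomMat τ) : Matrix ℕ ℕ ℂ) := by rw [DomMat.coe_sub, hP, DomMat.coe_one]; abel
  have hB : B = ((Q - 1 : DomMat τ) : Matrix ℕ ℕ ℂ) := by rw [DomMat.coe_sub, hQ, DomMat.coe_one]; abel
  have hring : P * Q = 1 + ((P - 1) + (Q - 1) + (P - 1) * (Q - 1)) := by noncomm_ring
  rw [hring, DomMat.coe_add, DomMat.coe_one, DomMat.coe_add, DomMat.coe_add, DomMat.coe_mul, ← hA, ← hB]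

/-- **First bicharacter property**: `f (s + s') t = f s t * f s' t`. The kernel of `Cm (s+s') t` is
`A + B + A B` with `A = X(-s') K_{s,t} X(s')`, `B = K_{s',t}`; multiplicativity of von Koch
determinants and Sylvester's identity `det (1 + X(-s') (K X s')) = det (1 + K X(s') X(-s')) = det (1 + K)`. [folklore] -/
theorem f_add_left (h : IsGeomSymbol V Cv r) (s s' t : ℂ) : f h (s + s') t = f h s t * f h s' t := by
  have hτ := (tau_pos h).le; have hτ1 := tau_lt_one h
  set A : Matrix ℕ ℕ ℂ := imul (X h (-s') : Matrix ℕ ℕ ℂ) (imul (K h s t) (X h s' : Matrix ℕ ℕ ℂ)) with hA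
  -- corner bounds
  have hKX : IsCorner (tau r) (kConst V r s t * xConst V r s') (imul (K h s t) (X h s' : Matrix ℕ ℕ ℂ)) :=
    (isCorner_K h s t).imul_colDom (isColDom_X h s') hτ
  have hAc : IsCorner (tau r) (xConst V r (-s') * (kConst V r s t * xConst V r s')) A :=
    (isRowDom_X h (-s')).imul_corner hKX hτ
  have hBc := isCorner_K h s' t
  -- the kernel of `Cm (s + s') t`
  have hker : 1 + K h (s + s') t = 1 + (A + K h s' t + imul A (K h s' t)) := by
    rw [← coe_Cm, Cm_add_left, coe_mul_eq_one_add _ _ A (K h s' t) (coe_conj_X h s s' t) (coe_Cm h s' t)]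
  have hker' : K h (s + s') t = A + K h s' t + imul A (K h s' t) := add_left_cancel hker
  -- Sylvester for `A`
  have hdetA : detOnePlus A = f h s t := by
    rw [hA, detOnePlus_imul_comm hKX (isRowDom_X h (-s')) (isColDom_X h (-s')) hτ hτ1, f]
    congr 1
    -- `(K X(s')) X(-s') = K`
    have hdom := (X h s').exists_isDom
    obtain ⟨a, C, ha, hC, hXd⟩ := hdom
    obtain ⟨a', C', ha', hC', hXd'⟩ := (X h (-s')).exists_isDom
    rw [imul_assoc (IsDom.of_isCorner (isCorner_K h s t)) hXd hXd' (IsWSeq.zero _) ha ha' hC hC'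
      (tau_pos h) hτ1]
    rw [show imul (X h s' : Matrix ℕ ℕ ℂ) (X h (-s') : Matrix ℕ ℕ ℂ) = ((X h s' * X h (-s') : DomMat (tau r)) :
      Matrix ℕ ℕ ℂ) from rfl, X_mul_X_neg, DomMat.coe_one, imul_one]
  rw [f, hker', detOnePlus_add_mul hAc hBc hτ hτ1, hdetA, f, f]

/-- **Second bicharacter property**: `f s (t + t') = f s t * f s t'`. [folklore] -/
theorem f_add_right (h : IsGeomSymbol V Cv r) (s t t' : ℂ) : f h s (t + t') = f h s t * f h s t' := by
  have hτ := (tau_pos h).le; have hτ1 := tau_lt_one h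
  set B : Matrix ℕ ℕ ℂ := imul (Y h t : Matrix ℕ ℕ ℂ) (imul (K h s t') (Y h (-t) : Matrix ℕ ℕ ℂ)) with hB
  have hKY : IsCorner (tau r) (kConst V r s t' * yConst V r (-t)) (imul (K h s t') (Y h (-t) : Matrix ℕ ℕ ℂ)) :=
    (isCorner_K h s t').imul_colDom (isColDom_Y h (-t)) hτ
  have hBc : IsCorner (tau r) (yConst V r t * (kConst V r s t' * yConst V r (-t))) B :=
    (isRowDom_Y h t).imul_corner hKY hτ
  have hAc := isCorner_K h s t
  have hker : 1 + K h s (t + t') = 1 + (K h s t + B + imul (K h s t) B) := by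
    rw [← coe_Cm, Cm_add_right, coe_mul_eq_one_add _ _ (K h s t) B (coe_Cm h s t) (coe_conj_Y h s t t')]
  have hker' : K h s (t + t') = K h s t + B + imul (K h s t) B := add_left_cancel hker
  have hdetB : detOnePlus B = f h s t' := by
    rw [hB, detOnePlus_imul_comm hKY (isRowDom_Y h t) (isColDom_Y h t) hτ hτ1, f]
    congr 1
    obtain ⟨a, C, ha, hC, hYd⟩ := (Y h (-t)).exists_isDom
    obtain ⟨a', C', ha', hC', hYd'⟩ := (Y h t).exists_isDom
    rw [imul_assoc (IsDom.of_isCorner (isCorner_K h s t')) hYd hYd' (IsWSeq.zero _) ha ha' hC hC'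
      (tau_pos h) hτ1]
    rw [show imul (Y h (-t) : Matrix ℕ ℕ ℂ) (Y h t : Matrix ℕ ℕ ℂ) = ((Y h (-t) * Y h t : DomMat (tau r)) :
      Matrix ℕ ℕ ℂ) from rfl, Y_mul_Y, neg_add_cancel, Y_zero, DomMat.coe_one, imul_one]
  rw [f, hker', detOnePlus_add_mul hAc hBc hτ hτ1, hdetB, f, f]

/-- **Doubling**: `f (2s) t = (f s t)^2` and `f s (2t) = (f s t)^2`, hence by induction
**`f 1 1 = (f (2^{-m}) (2^{-m}))^(4^m)`**. [folklore] -/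
theorem f_one_one_eq_pow (h : IsGeomSymbol V Cv r) (m : ℕ) :
    f h 1 1 = (f h ((2 : ℂ) ^ (-(m : ℤ))) ((2 : ℂ) ^ (-(m : ℤ)))) ^ (4 ^ m) := by
  induction m with
  | zero => simp
  | succ m ih =>
    set ε : ℂ := (2 : ℂ) ^ (-((m + 1 : ℕ) : ℤ)) with hε
    have h2ε : (2 : ℂ) ^ (-(m : ℤ)) = ε + ε := by
      rw [hε, ← two_mul, ← zpow_one_add₀ (two_ne_zero : (2 : ℂ) ≠ 0)]
      congr 1; push_cast; ring
    rw [ih, h2ε, f_add_left, f_add_right, pow_succ, pow_mul]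
    ring

end Matrices

end Szego

end Literature.Analysis.Toeplitz
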